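import Mathlib
import Summits.Ventures.DiscreteObjects.Mahler.SubLehmerNoCyclotomicRoot
import Summits.Ventures.DiscreteObjects.Mahler.CyclotomicIntegerSchinzelMeasure
import Summits.Ventures.DiscreteObjects.Mahler.SymmetricRootIntegrality
import Summits.Ventures.DiscreteObjects.Mahler.SubLehmerDegreeTwentyEight
import Summits.Ventures.DiscreteObjects.Mahler.MahlerMeasureCompXPow

/-!
# Powers of roots of a sub-Lehmer polynomial avoid the cyclotomic fields (venture `DiscreteObjects`, target L)

Cell `pub-namedobj`, seat `pub-namedobj-mahler-g28`. Framing: lottery ticket; floor = certified bounds/negative ranges.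

Census reading of Schinzel's bound for cyclotomic integers (`CyclotomicIntegerSchinzelMeasure`: `φ^{deg β} ≤ M(β)²` for a
nonzero non-torsion algebraic integer `β` of a cyclotomic field) combined with the multiplicativity of the height,
`h(α^k) = k h(α)`, in Mahler-measure form:
* `prod_X_sub_C_aeval_roots_lifts`: for `f ∈ ℤ[X]` monic with roots `α_i` and `g ∈ ℤ[X]`, `∏_i (X - g(α_i)) ∈ ℤ[X]`
  (symmetric functions, `SymmetricRootIntegrality`);
* `measure_pow_eq_measure_pow_minpoly_pow`: `M(α)^k = M(α^k)^e` with `e · deg(α^k) = deg α`;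
* `goldenRatio_pow_le_measure_pow_of_pow_mem_cyclotomicField`: `α^k ∈ ℚ(ζ_m)` (`k ≥ 1`, `α ≠ 0` integral, not a root of
  unity) ⇒ `φ^{deg α} ≤ M(α)^{2k}`;
* **`subLehmer_irreducible_root_pow_not_mem_cyclotomicField`**: if `P ∈ ℤ[X]` is irreducible with `1 < M(P) < M(ℓ)` and
  `α` is a root of `P`, then `α^k ∉ ℚ(ζ_m)` for every `m ≥ 1` and every `1 ≤ k ≤ 41` (`deg P ≥ 28` by 'Lehmer ≤ 27' and
  `φ^{28} > M(ℓ)^{82}`); `k = 1` is `SubLehmerNoCyclotomicRoot`.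
Source bound: Schinzel 1973 via [cite: BombieriGubler2001, Proposition 1.6.6]-type bookkeeping; no new mathematics claimed.
-/

namespace Summit.Ventures.DiscreteObjects.Mahler

open Polynomial Finset

/-- For a monic `f ∈ ℤ[X]` with complex roots `α_1, …, α_n` (enumerated by `α : Fin n → ℂ`) and any `g ∈ ℤ[X]`, the
polynomial `∏_i (X - g(α_i))` has integer coefficients (symmetric functions of the roots). -/
theorem prod_X_sub_C_aeval_roots_lifts {n : ℕ} (f : ℤ[X]) (hmon : f.Monic) (α : Fin n → ℂ)
    (hα : (Finset.univ.val.map α : Multiset ℂ) = (f.map (Int.castRingHom ℂ)).roots) (g : ℤ[X]) :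
    (∏ i : Fin n, (X - C (aeval (α i) g))) ∈ Polynomial.lifts (Int.castRingHom ℂ) := by
  classical
  set Q : Polynomial (MvPolynomial (Fin n) ℤ) :=
    ∏ i : Fin n, (X - C (aeval (MvPolynomial.X i : MvPolynomial (Fin n) ℤ) g)) with hQ
  have hQsymm : ∀ k : ℕ, (Q.coeff k).IsSymmetric := by
    intro k e
    have hmap : Q.map (MvPolynomial.rename e).toRingHom = Q := by
      rw [hQ, Polynomial.map_prod]
      simp only [Polynomial.map_sub, Polynomial.map_X, Polynomial.map_C, AlgHom.toRingHom_eq_coe, RingHom.coe_coe]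
      have h1 : ∀ i : Fin n, (MvPolynomial.rename e) (aeval (MvPolynomial.X i : MvPolynomial (Fin n) ℤ) g) =
          aeval (MvPolynomial.X (e i) : MvPolynomial (Fin n) ℤ) g := by
        intro i
        rw [← Polynomial.aeval_algHom_apply, MvPolynomial.rename_X]
      simp_rw [h1]
      exact Fintype.prod_equiv e _ (fun i => X - C (aeval (MvPolynomial.X i : MvPolynomial (Fin n) ℤ) g)) (fun i => rfl)
    have h := congrArg (fun R => R.coeff k) hmap
    simp only [Polynomial.coeff_map, AlgHom.toRingHom_eq_coe, RingHom.coe_coe] at h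
    exact h
  have hQeval : Q.map (MvPolynomial.aeval α).toRingHom = ∏ i : Fin n, (X - C (aeval (α i) g)) := by
    rw [hQ, Polynomial.map_prod]
    simp only [Polynomial.map_sub, Polynomial.map_X, Polynomial.map_C, AlgHom.toRingHom_eq_coe, RingHom.coe_coe]
    have h1 : ∀ i : Fin n, (MvPolynomial.aeval α) (aeval (MvPolynomial.X i : MvPolynomial (Fin n) ℤ) g) = aeval (α i) g := by
      intro i
      rw [← Polynomial.aeval_algHom_apply, MvPolynomial.aeval_X]
    simp_rw [h1]
  rw [lifts_iff_coeff_lifts]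
  intro k
  obtain ⟨z, hz⟩ := exists_int_eq_aeval_of_isSymmetric f hmon α hα (Q.coeff k) (hQsymm k)
  refine ⟨z, ?_⟩
  rw [← hQeval, Polynomial.coeff_map, AlgHom.toRingHom_eq_coe, RingHom.coe_coe, hz, eq_intCast]

/-- Mahler measure of a product of linear factors indexed by any finite type. -/
theorem mahlerMeasure_finprod_X_sub_C {ι : Type*} (s : Finset ι) (a : ι → ℂ) :
    (∏ i ∈ s, (X - C (a i))).mahlerMeasure = ∏ i ∈ s, max 1 ‖a i‖ := by
  classical
  induction s using Finset.induction_on with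
  | empty => simp [mahlerMeasure_one]
  | insert x s hx ih => rw [Finset.prod_insert hx, Finset.prod_insert hx, mahlerMeasure_mul, mahlerMeasure_X_sub_C, ih]

/-- **Mahler measure of a power.**  For an algebraic integer `α` and `k ≥ 1`: `M(α)^k = M(α^k)^e` with
`e · deg(α^k) = deg α` (`e = [ℚ(α) : ℚ(α^k)]`), i.e. `h(α^k) = k·h(α)`.  The polynomial `∏_i (X - α_i^k)` over the
conjugates `α_i` of `α` is an integer polynomial of measure `M(α)^k` and a power of `minpoly_ℤ(α^k)`. -/
theorem measure_pow_eq_measure_pow_minpoly_pow {α : ℂ} (hint : IsIntegral ℤ α) (k : ℕ) :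
    ∃ e : ℕ, e ≠ 0 ∧ e * (minpoly ℤ (α ^ k)).natDegree = (minpoly ℤ α).natDegree ∧
      intMahlerMeasure (minpoly ℤ α) ^ k = intMahlerMeasure (minpoly ℤ (α ^ k)) ^ e := by
  classical
  set f : ℤ[X] := minpoly ℤ α with hf
  have hfmon : f.Monic := minpoly.monic hint
  have hfdeg : 0 < f.natDegree := minpoly.natDegree_pos hint
  -- the roots of `f` as a family `ρ : Fin n → ℂ`
  set fc := f.map (Int.castRingHom ℂ) with hfc
  set R := fc.roots with hR
  have hcard : R.card = f.natDegree := by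
    rw [hR, splits_iff_card_roots.1 (IsAlgClosed.splits fc), hfc,
      natDegree_map_eq_of_injective (Int.castRingHom ℂ).injective_int]
  set L := R.toList with hL
  set n := L.length with hn
  have hnd : n = f.natDegree := by rw [hn, hL, Multiset.length_toList, hcard]
  set ρ : Fin n → ℂ := fun i => L.get i with hρdef
  have hρ : (Finset.univ.val.map ρ : Multiset ℂ) = R := by
    rw [Fin.univ_val_map]
    have hof : List.ofFn ρ = L := List.ofFn_get L
    rw [hof]
    exact Multiset.coe_toList R
  -- the integer polynomial `F` with `F = ∏ (X - ρ_i^k)` over `ℂ`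
  have hlift : (∏ i : Fin n, (X - C (ρ i ^ k))) ∈ Polynomial.lifts (Int.castRingHom ℂ) := by
    have h := prod_X_sub_C_aeval_roots_lifts f hfmon ρ hρ (X ^ k)
    simp only [aeval_X_pow] at h
    exact h
  set Fc : ℂ[X] := ∏ i : Fin n, (X - C (ρ i ^ k)) with hFc
  have hFcmon : Fc.Monic := monic_prod_of_monic _ _ (fun _ _ => monic_X_sub_C _)
  obtain ⟨F, hFmap, hFdeg, hFmon⟩ := lifts_and_natDegree_eq_and_monic hlift hFcmon
  have hFcdeg : Fc.natDegree = n := by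
    rw [hFc, natDegree_prod_of_monic _ _ (fun _ _ => monic_X_sub_C _)]
    simp only [natDegree_X_sub_C, Finset.sum_const, Finset.card_univ, Fintype.card_fin, smul_eq_mul, mul_one]
  -- `β = α^k` and its minimal polynomial
  set β : ℂ := α ^ k with hβ
  have hβint : IsIntegral ℤ β := hint.pow k
  set fβ : ℤ[X] := minpoly ℤ β with hfβ
  have hfβmon : fβ.Monic := minpoly.monic hβint
  have hfβirr : Irreducible fβ := minpoly.irreducible hβint
  -- every `ρ_i^k` is a root of `fβ`: `f ∣ fβ(X^k)`
  have hdvd : f ∣ expand ℤ k fβ := by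
    refine minpoly.isIntegrallyClosed_dvd hint ?_
    rw [expand_aeval, ← hβ, hfβ, minpoly.aeval]
  have hρroot : ∀ i : Fin n, aeval (ρ i ^ k) fβ = 0 := by
    intro i
    have hmem : ρ i ∈ R := by
      rw [← hρ]; exact Multiset.mem_map.2 ⟨i, Finset.mem_univ_val i, rfl⟩
    have hfi : aeval (ρ i) f = 0 := by
      have h := (mem_roots (hfmon.map (Int.castRingHom ℂ)).ne_zero).1 hmem
      rwa [IsRoot.def, eval_map, ← algebraMap_int_eq, ← aeval_def] at h
    obtain ⟨q, hq⟩ := hdvd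
    have h2 : aeval (ρ i) (expand ℤ k fβ) = 0 := by rw [hq, map_mul, hfi, zero_mul]
    rwa [expand_aeval] at h2
  have hFroots : ∀ z : ℂ, z ∈ (F.map (Int.castRingHom ℂ)).roots → aeval z fβ = 0 := by
    intro z hz
    rw [hFmap, hFc] at hz
    have hmm : (Finset.univ.val.map fun i : Fin n => X - C (ρ i ^ k)) =
        ((Finset.univ.val.map fun i : Fin n => ρ i ^ k).map fun a : ℂ => X - C a) := by
      rw [Multiset.map_map]; rfl
    rw [Finset.prod_eq_multiset_prod, hmm, roots_multiset_prod_X_sub_C, Multiset.mem_map] at hz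
    obtain ⟨i, -, rfl⟩ := hz
    exact hρroot i
  obtain ⟨e, hFe⟩ := eq_pow_of_roots_subset hfβmon hfβirr _ F rfl hFmon hFroots
  have hed : e * fβ.natDegree = f.natDegree := by
    rw [← hnd, ← hFcdeg, ← hFdeg, hFe, natDegree_pow]
  have he0 : e ≠ 0 := by
    intro he
    rw [he, zero_mul] at hed
    omega
  -- measures
  have hMf : intMahlerMeasure f = ∏ i : Fin n, max 1 ‖ρ i‖ := by
    unfold intMahlerMeasure
    rw [mahlerMeasure_eq_leadingCoeff_mul_prod_roots, (hfmon.map (Int.castRingHom ℂ)).leadingCoeff, norm_one, one_mul,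
      ← hfc, ← hR, ← hρ, Multiset.map_map]
    rfl
  have hMF : intMahlerMeasure F = ∏ i : Fin n, max 1 ‖ρ i ^ k‖ := by
    unfold intMahlerMeasure
    rw [hFmap, hFc]
    exact mahlerMeasure_finprod_X_sub_C (Finset.univ : Finset (Fin n)) (fun i => ρ i ^ k)
  have hMFk : intMahlerMeasure F = intMahlerMeasure f ^ k := by
    rw [hMF, hMf, ← Finset.prod_pow]
    refine Finset.prod_congr rfl fun i _ => ?_
    rw [norm_pow, max_one_pow (norm_nonneg _)]
  have hMFe : intMahlerMeasure F = intMahlerMeasure fβ ^ e := by rw [hFe, intMahlerMeasure_pow]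
  exact ⟨e, he0, hed, by rw [← hMFk, hMFe]⟩

/-- **If a power of an algebraic integer lies in a cyclotomic field** (`α^k ∈ ℚ(ζ_m)`, `k ≥ 1`, `α ≠ 0` not a root of
unity), Schinzel's bound for the cyclotomic integer `α^k` gives `φ^{deg α} ≤ M(α)^{2k}`, i.e. `h(α) ≥ (log φ)/(2k)`. -/
theorem goldenRatio_pow_le_measure_pow_of_pow_mem_cyclotomicField {m : ℕ} (hm : 0 < m) {ζ : ℂ} (hζ : IsPrimitiveRoot ζ m)
    {α : ℂ} (hint : IsIntegral ℤ α) (h0 : α ≠ 0) (hnu : ∀ j : ℕ, 0 < j → α ^ j ≠ 1) {k : ℕ} (hk : 0 < k)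
    (hmem : α ^ k ∈ IntermediateField.adjoin ℚ {ζ}) :
    Real.goldenRatio ^ (minpoly ℤ α).natDegree ≤ intMahlerMeasure (minpoly ℤ α) ^ (2 * k) := by
  obtain ⟨e, he0, hed, hM⟩ := measure_pow_eq_measure_pow_minpoly_pow hint k
  obtain ⟨g, hg⟩ := exists_aeval_eq_of_isIntegral_of_mem_adjoin hm hζ hmem (hint.pow k)
  have hβ0 : aeval ζ g ≠ 0 := by rw [← hg]; exact pow_ne_zero _ h0
  have hβnu : ∀ j : ℕ, 0 < j → aeval ζ g ^ j ≠ 1 := by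
    intro j hj h1
    rw [← hg, ← pow_mul] at h1
    exact hnu (k * j) (Nat.mul_pos hk hj) h1
  have hS := goldenRatio_pow_le_measure_sq hm g hζ hβ0 hβnu
  rw [← hg] at hS
  have hM0 : 0 ≤ intMahlerMeasure (minpoly ℤ (α ^ k)) :=
    le_trans zero_le_one (one_le_intMahlerMeasure (minpoly.monic (hint.pow k)).ne_zero)
  calc Real.goldenRatio ^ (minpoly ℤ α).natDegree
      = (Real.goldenRatio ^ (minpoly ℤ (α ^ k)).natDegree) ^ e := by rw [← pow_mul, mul_comm, hed]
    _ ≤ (intMahlerMeasure (minpoly ℤ (α ^ k)) ^ 2) ^ e := pow_le_pow_left₀ (by positivity) hS e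
    _ = (intMahlerMeasure (minpoly ℤ (α ^ k)) ^ e) ^ 2 := by rw [← pow_mul, ← pow_mul, mul_comm]
    _ = intMahlerMeasure (minpoly ℤ α) ^ (2 * k) := by rw [← hM, ← pow_mul, mul_comm]

/-- `φ^{28} > 1.17629^{82}` (numerics for `k ≤ 41`). -/
theorem lehmer_pow_82_lt_goldenRatio_pow_28 : ((117629 : ℝ) / 100000) ^ 82 < Real.goldenRatio ^ 28 := by
  have hs : (2236 : ℝ) / 1000 < √5 := by
    rw [show (2236 : ℝ) / 1000 = √((2236 / 1000) ^ 2) by rw [Real.sqrt_sq (by norm_num)]]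
    exact Real.sqrt_lt_sqrt (by norm_num) (by norm_num)
  have hφ : (1618 : ℝ) / 1000 < Real.goldenRatio := by
    rw [Real.goldenRatio]; linarith
  calc ((117629 : ℝ) / 100000) ^ 82 < ((1618 : ℝ) / 1000) ^ 28 := by norm_num
    _ ≤ Real.goldenRatio ^ 28 := pow_le_pow_left₀ (by norm_num) hφ.le 28

/-- **No small power of a root of a sub-Lehmer polynomial lies in a cyclotomic field.**  If `P ∈ ℤ[X]` is irreducible with
`1 < M(P) < M(ℓ)` and `α` is a complex root of `P`, then `α^k ∉ ℚ(ζ_m)` for every `m ≥ 1` and every `1 ≤ k ≤ 41` (indeed for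
every `k < deg P · log φ / (2 log M(ℓ)) ≈ 1.48 deg P`; `deg P ≥ 28` by the kernel census). -/
theorem subLehmer_irreducible_root_pow_not_mem_cyclotomicField {P : ℤ[X]} (hirr : Irreducible P) (hP : SubLehmer P)
    {m : ℕ} (hm : 0 < m) {ζ : ℂ} (hζ : IsPrimitiveRoot ζ m) {α : ℂ} (hroot : aeval α P = 0) {k : ℕ} (hk : 0 < k)
    (hk41 : k ≤ 41) : α ^ k ∉ IntermediateField.adjoin ℚ {ζ} := by
  intro hmem
  have hint : IsIntegral ℤ α := isIntegral_root_of_subLehmer_irreducible hirr hP hroot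
  -- `α ≠ 0`, not a root of unity
  have h0 : α ≠ 0 := by
    intro h0
    apply core_coeff_zero_ne_zero hirr hP
    have h := hroot
    rw [h0, aeval_def, eval₂_at_zero, algebraMap_int_eq, eq_intCast] at h
    exact_mod_cast h
  have hnu : ∀ j : ℕ, 0 < j → α ^ j ≠ 1 := by
    intro j hj hj1
    have hfin : IsOfFinOrder α := isOfFinOrder_iff_pow_eq_one.2 ⟨j, hj, hj1⟩
    have hord : 0 < orderOf α := hfin.orderOf_pos
    apply core_not_cyclotomic_dvd hirr hP hord
    rw [cyclotomic_eq_minpoly (IsPrimitiveRoot.orderOf α) hord]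
    exact minpoly.isIntegrallyClosed_dvd hint hroot
  have hB := goldenRatio_pow_le_measure_pow_of_pow_mem_cyclotomicField hm hζ hint h0 hnu hk hmem
  -- `minpoly_ℤ α` and `P` are associated: same degree, `M(minpoly α) ≤ M(P) < M(ℓ)`
  have hdvd : minpoly ℤ α ∣ P := minpoly.isIntegrallyClosed_dvd hint hroot
  have hassoc : Associated (minpoly ℤ α) P := (minpoly.irreducible hint).associated_of_dvd hirr hdvd
  have hdeg : (minpoly ℤ α).natDegree = P.natDegree :=
    natDegree_eq_of_degree_eq (degree_eq_degree_of_associated hassoc)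
  have hMle : intMahlerMeasure (minpoly ℤ α) ≤ intMahlerMeasure P := intMahlerMeasure_le_of_dvd hirr.ne_zero hdvd
  have hM0 : 0 ≤ intMahlerMeasure (minpoly ℤ α) :=
    le_trans zero_le_one (one_le_intMahlerMeasure (minpoly.monic hint).ne_zero)
  have hL := lehmer_measure_upper_bound
  have h28 : 28 ≤ P.natDegree := twentyeight_le_natDegree_of_subLehmer hP
  have hφ1 : (1 : ℝ) ≤ Real.goldenRatio := Real.one_lt_goldenRatio.le
  have hnum := lehmer_pow_82_lt_goldenRatio_pow_28
  -- chain: `φ^28 ≤ φ^deg ≤ M(minpoly)^{2k} ≤ 1.17629^{2k} ≤ 1.17629^{82}`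
  have h1 : Real.goldenRatio ^ 28 ≤ Real.goldenRatio ^ (minpoly ℤ α).natDegree :=
    pow_le_pow_right₀ hφ1 (by rw [hdeg]; exact h28)
  have h2 : intMahlerMeasure (minpoly ℤ α) ^ (2 * k) ≤ ((117629 : ℝ) / 100000) ^ (2 * k) :=
    pow_le_pow_left₀ hM0 (by linarith [hP.2]) _
  have h3 : ((117629 : ℝ) / 100000) ^ (2 * k) ≤ ((117629 : ℝ) / 100000) ^ 82 :=
    pow_le_pow_right₀ (by norm_num) (by omega)
  linarith

/-- `M(ℓ)^{8} < φ^{3}` (so `M(ℓ)^{2k} < φ^{d}` whenever `3k ≤ 4d`). -/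
theorem lehmer_pow_eight_lt_goldenRatio_pow_three : ((117629 : ℝ) / 100000) ^ 8 < Real.goldenRatio ^ 3 := by
  have hs : (2236 : ℝ) / 1000 < √5 := by
    rw [show (2236 : ℝ) / 1000 = √((2236 / 1000) ^ 2) by rw [Real.sqrt_sq (by norm_num)]]
    exact Real.sqrt_lt_sqrt (by norm_num) (by norm_num)
  have hφ : (1618 : ℝ) / 1000 < Real.goldenRatio := by
    rw [Real.goldenRatio]; linarith
  calc ((117629 : ℝ) / 100000) ^ 8 < ((1618 : ℝ) / 1000) ^ 3 := by norm_num
    _ ≤ Real.goldenRatio ^ 3 := pow_le_pow_left₀ (by norm_num) hφ.le 3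

/-- **Degree-relative form**: if `P ∈ ℤ[X]` is irreducible and sub-Lehmer of degree `d` and `α` is a root of `P`, then `α^k ∉ ℚ(ζ_m)`
for every `m ≥ 1` and every `k ≥ 1` with `3k ≤ 4d` (e.g. all `k ≤ 37` at `d = 28`, all `k ≤ 4d/3` in general; the true range of the
argument is `k < d · log φ / (2 log M(ℓ)) ≈ 1.48 d`). -/
theorem subLehmer_irreducible_root_pow_not_mem_cyclotomicField' {P : ℤ[X]} (hirr : Irreducible P) (hP : SubLehmer P)
    {m : ℕ} (hm : 0 < m) {ζ : ℂ} (hζ : IsPrimitiveRoot ζ m) {α : ℂ} (hroot : aeval α P = 0) {k : ℕ} (hk : 0 < k)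
    (hkd : 3 * k ≤ 4 * P.natDegree) : α ^ k ∉ IntermediateField.adjoin ℚ {ζ} := by
  intro hmem
  have hint : IsIntegral ℤ α := isIntegral_root_of_subLehmer_irreducible hirr hP hroot
  have h0 : α ≠ 0 := by
    intro h0
    apply core_coeff_zero_ne_zero hirr hP
    have h := hroot
    rw [h0, aeval_def, eval₂_at_zero, algebraMap_int_eq, eq_intCast] at h
    exact_mod_cast h
  have hnu : ∀ j : ℕ, 0 < j → α ^ j ≠ 1 := by
    intro j hj hj1
    have hfin : IsOfFinOrder α := isOfFinOrder_iff_pow_eq_one.2 ⟨j, hj, hj1⟩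
    have hord : 0 < orderOf α := hfin.orderOf_pos
    apply core_not_cyclotomic_dvd hirr hP hord
    rw [cyclotomic_eq_minpoly (IsPrimitiveRoot.orderOf α) hord]
    exact minpoly.isIntegrallyClosed_dvd hint hroot
  have hB := goldenRatio_pow_le_measure_pow_of_pow_mem_cyclotomicField hm hζ hint h0 hnu hk hmem
  have hdvd : minpoly ℤ α ∣ P := minpoly.isIntegrallyClosed_dvd hint hroot
  have hassoc : Associated (minpoly ℤ α) P := (minpoly.irreducible hint).associated_of_dvd hirr hdvd
  have hdeg : (minpoly ℤ α).natDegree = P.natDegree :=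
    natDegree_eq_of_degree_eq (degree_eq_degree_of_associated hassoc)
  have hMle : intMahlerMeasure (minpoly ℤ α) ≤ intMahlerMeasure P := intMahlerMeasure_le_of_dvd hirr.ne_zero hdvd
  have hM0 : 0 ≤ intMahlerMeasure (minpoly ℤ α) :=
    le_trans zero_le_one (one_le_intMahlerMeasure (minpoly.monic hint).ne_zero)
  have hL := lehmer_measure_upper_bound
  set d := P.natDegree with hd
  set L : ℝ := (117629 : ℝ) / 100000 with hLdef
  -- `φ^d ≤ M(minpoly α)^{2k} ≤ L^{2k}` and `(L^{2k})^3 ≤ (L^8)^d < (φ^3)^d = (φ^d)^3`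
  have h1 : Real.goldenRatio ^ d ≤ L ^ (2 * k) := by
    rw [← hdeg]
    exact hB.trans (pow_le_pow_left₀ hM0 (by linarith [hP.2]) _)
  have hL1 : (1 : ℝ) ≤ L := by rw [hLdef]; norm_num
  have h2 : (L ^ (2 * k)) ^ 3 ≤ (L ^ 8) ^ d := by
    rw [← pow_mul, ← pow_mul]
    exact pow_le_pow_right₀ hL1 (by omega)
  have h3 : (L ^ 8) ^ d < (Real.goldenRatio ^ 3) ^ d := by
    have hdpos : d ≠ 0 := by
      have := twentyeight_le_natDegree_of_subLehmer hP; omega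
    exact pow_lt_pow_left₀ lehmer_pow_eight_lt_goldenRatio_pow_three (by positivity) hdpos
  have h4 : (Real.goldenRatio ^ d) ^ 3 ≤ (L ^ (2 * k)) ^ 3 :=
    pow_le_pow_left₀ (by positivity) h1 3
  have h5 : (Real.goldenRatio ^ 3) ^ d = (Real.goldenRatio ^ d) ^ 3 := by rw [← pow_mul, ← pow_mul, mul_comm]
  linarith
end Summit.Ventures.DiscreteObjects.Mahler
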